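import Mathlib
import HarnessLib

/-!
# A discrete smooth cutoff and the decay of its finite Fourier transform (helper toward
`stub_poissonReduction`, line `cofactor-root-discrepancy`, crux `SplitBlockJacobi`,
stmt-Parity-11583)

The weight is the `k`-fold discrete convolution of the indicator of `(M, N]` with the box filter
`(1/L)·1_{[0,L)}`, encoded by POLYNOMIALS over `ℕ`:

`c_k(t) := coeff_t ( (Σ_{M < s ≤ N} X^s) · (Σ_{j < L} X^j)^k )`, `w(t) := c_k(t)/L^k`.

We prove (all elementary):
* `0 ≤ c_k(t) ≤ L^k`; `c_k(t) = L^k` for `M + 1 + k(L-1) ≤ t ≤ N`; `c_k(t) = 0` for `t ≤ M` and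
  for `t > N + k(L-1)` (`coeff_cutoff_le`, `coeff_cutoff_eq`, `coeff_cutoff_eq_zero_of_le`,
  `coeff_cutoff_eq_zero_of_lt`);
* the product formula for its finite Fourier transform (it is `eval₂` of a product),
  `Σ_{1 ≤ t ≤ x} c_k(t) z^t = (Σ_{M<s≤N} z^s)(Σ_{j<L} z^j)^k` (`sum_coeff_cutoff_mul_pow`);
* the geometric-sum bound `|Σ_{j<n} e(u)^j| ≤ 1/(2|u|)` for `0 < |u| ≤ 1/2`
  (`norm_geom_sum_exp_le`, from `|e(u) - 1| = 2|sin πu| ≥ 4|u|`);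
* the DECAY `|Σ_t w(t) e(ht/q)| ≤ (q/(2|h|))^{k+1}/L^k` for `0 < 2|h| ≤ q`
  (`norm_cutoff_fourier_le`).
-/

noncomputable section

open Finset Polynomial

namespace Summit.Parity.BatemanHorn.Cruxes.SplitBlockJacobi.CofactorRootDiscrepancy.Poisson

/-- The cutoff polynomial `(Σ_{M < s ≤ N} X^s) · (Σ_{j < L} X^j)^k ∈ ℕ[X]` (local notation). -/
local notation3 "cutoffPoly[" M ", " N ", " L ", " k "]" =>
  ((∑ s ∈ Finset.Ioc M N, (Polynomial.X : Polynomial ℕ) ^ s) *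
    (∑ j ∈ Finset.range L, (Polynomial.X : Polynomial ℕ) ^ j) ^ k)

/-! ### Coefficients -/

/-- Coefficients of the indicator polynomial. -/
theorem coeff_sum_X_pow_Ioc (M N t : ℕ) :
    (∑ s ∈ Finset.Ioc M N, (Polynomial.X : Polynomial ℕ) ^ s).coeff t =
      if t ∈ Finset.Ioc M N then 1 else 0 := by
  rw [Polynomial.finsetSum_coeff]
  simp_rw [Polynomial.coeff_X_pow]
  exact Finset.sum_ite_eq (Finset.Ioc M N) t (fun _ => (1 : ℕ))

/-- Multiplying by the box polynomial convolves the coefficients with `1_{[0,L)}`. -/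
theorem coeff_mul_boxPoly (P : Polynomial ℕ) (L t : ℕ) :
    (P * ∑ j ∈ Finset.range L, (Polynomial.X : Polynomial ℕ) ^ j).coeff t =
      ∑ j ∈ Finset.range L, if j ≤ t then P.coeff (t - j) else 0 := by
  rw [Finset.mul_sum, Polynomial.finsetSum_coeff]
  refine Finset.sum_congr rfl fun j _ => ?_
  exact Polynomial.coeff_mul_X_pow' P j t

/-- The four coefficient facts, proved together by induction on `k`. -/
theorem coeff_cutoff_spec (M N L : ℕ) (hL : 0 < L) :
    ∀ k t : ℕ, ((cutoffPoly[M, N, L, k]).coeff t ≤ L ^ k) ∧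
      (M + 1 + k * (L - 1) ≤ t → t ≤ N → (cutoffPoly[M, N, L, k]).coeff t = L ^ k) ∧
      (t ≤ M → (cutoffPoly[M, N, L, k]).coeff t = 0) ∧
      (N + k * (L - 1) < t → (cutoffPoly[M, N, L, k]).coeff t = 0) := by
  intro k
  induction k with
  | zero =>
    intro t
    simp only [pow_zero, mul_one, zero_mul, add_zero, coeff_sum_X_pow_Ioc, Finset.mem_Ioc]
    refine ⟨?_, ?_, ?_, ?_⟩
    · split_ifs <;> omega
    · intro h1 h2; rw [if_pos ⟨by omega, h2⟩]
    · intro h; rw [if_neg (by omega)]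
    · intro h; rw [if_neg (by omega)]
  | succ k ih =>
    intro t
    have hrec : (cutoffPoly[M, N, L, k + 1]).coeff t =
        ∑ j ∈ Finset.range L, if j ≤ t then (cutoffPoly[M, N, L, k]).coeff (t - j) else 0 := by
      rw [pow_succ, ← mul_assoc, coeff_mul_boxPoly]
    have hD : (k + 1) * (L - 1) = k * (L - 1) + (L - 1) := by ring
    rw [hrec]
    refine ⟨?_, ?_, ?_, ?_⟩
    · -- bound
      calc ∑ j ∈ Finset.range L, (if j ≤ t then (cutoffPoly[M, N, L, k]).coeff (t - j) else 0)
          ≤ ∑ j ∈ Finset.range L, L ^ k := Finset.sum_le_sum fun j _ => by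
            split_ifs
            · exact (ih (t - j)).1
            · exact Nat.zero_le _
        _ = L ^ (k + 1) := by rw [Finset.sum_const, Finset.card_range, smul_eq_mul, pow_succ']
    · -- plateau
      intro h1 h2
      rw [hD] at h1
      calc ∑ j ∈ Finset.range L, (if j ≤ t then (cutoffPoly[M, N, L, k]).coeff (t - j) else 0)
          = ∑ j ∈ Finset.range L, L ^ k := Finset.sum_congr rfl fun j hj => by
            rw [Finset.mem_range] at hj
            rw [if_pos (by omega)]
            exact (ih (t - j)).2.1 (by omega) (by omega)
        _ = L ^ (k + 1) := by rw [Finset.sum_const, Finset.card_range, smul_eq_mul, pow_succ']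
    · -- zero below
      intro h
      refine Finset.sum_eq_zero fun j _ => ?_
      split_ifs
      · exact (ih (t - j)).2.2.1 (by omega)
      · rfl
    · -- zero above
      intro h
      rw [hD] at h
      refine Finset.sum_eq_zero fun j hj => ?_
      rw [Finset.mem_range] at hj
      split_ifs
      · exact (ih (t - j)).2.2.2 (by omega)
      · rfl

/-- `c_k(t) ≤ L^k`. -/
theorem coeff_cutoff_le (M N L k t : ℕ) (hL : 0 < L) :
    (cutoffPoly[M, N, L, k]).coeff t ≤ L ^ k :=
  (coeff_cutoff_spec M N L hL k t).1

/-- `c_k(t) = L^k` on the plateau `M + 1 + k(L-1) ≤ t ≤ N`. -/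
theorem coeff_cutoff_eq (M N L k t : ℕ) (hL : 0 < L) (h1 : M + 1 + k * (L - 1) ≤ t)
    (h2 : t ≤ N) : (cutoffPoly[M, N, L, k]).coeff t = L ^ k :=
  (coeff_cutoff_spec M N L hL k t).2.1 h1 h2

/-- `c_k(t) = 0` for `t ≤ M`. -/
theorem coeff_cutoff_eq_zero_of_le (M N L k t : ℕ) (hL : 0 < L) (h : t ≤ M) :
    (cutoffPoly[M, N, L, k]).coeff t = 0 :=
  (coeff_cutoff_spec M N L hL k t).2.2.1 h

/-- `c_k(t) = 0` for `t > N + k(L-1)`. -/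
theorem coeff_cutoff_eq_zero_of_lt (M N L k t : ℕ) (hL : 0 < L) (h : N + k * (L - 1) < t) :
    (cutoffPoly[M, N, L, k]).coeff t = 0 :=
  (coeff_cutoff_spec M N L hL k t).2.2.2 h

/-! ### The finite Fourier transform is a product -/

/-- `Σ_{i ≤ x} f i = f 0 + Σ_{1 ≤ t ≤ x} f t`. -/
theorem sum_range_succ_eq_add_sum_Icc {β : Type*} [AddCommMonoid β] (f : ℕ → β) (x : ℕ) :
    ∑ i ∈ Finset.range (x + 1), f i = f 0 + ∑ t ∈ Finset.Icc 1 x, f t := by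
  rw [Finset.range_eq_Ico, Finset.sum_eq_sum_Ico_succ_bot (Nat.succ_pos x)]
  congr 1

/-- `Σ_{1 ≤ t ≤ x} c_k(t) z^t = (Σ_{M < s ≤ N} z^s) · (Σ_{j < L} z^j)^k` whenever the support
`(M, N + k(L-1)]` lies in `[1, x]`. -/
theorem sum_coeff_cutoff_mul_pow (M N L k x : ℕ) (hL : 0 < L) (hx : N + k * (L - 1) ≤ x)
    (z : ℂ) :
    ∑ t ∈ Finset.Icc 1 x, (((cutoffPoly[M, N, L, k]).coeff t : ℕ) : ℂ) * z ^ t =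
      (∑ s ∈ Finset.Ioc M N, z ^ s) * (∑ j ∈ Finset.range L, z ^ j) ^ k := by
  have hdeg : (cutoffPoly[M, N, L, k]).natDegree < x + 1 := by
    rw [Nat.lt_succ_iff, Polynomial.natDegree_le_iff_coeff_eq_zero]
    intro t ht
    exact coeff_cutoff_eq_zero_of_lt M N L k t hL (by omega)
  have hev := Polynomial.eval₂_eq_sum_range' (Nat.castRingHom ℂ) hdeg z
  rw [Polynomial.eval₂_mul, Polynomial.eval₂_pow, Polynomial.eval₂_finsetSum,
    Polynomial.eval₂_finsetSum] at hev
  simp only [Polynomial.eval₂_X_pow, eq_natCast] at hev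
  rw [hev, sum_range_succ_eq_add_sum_Icc, coeff_cutoff_eq_zero_of_le M N L k 0 hL (Nat.zero_le _)]
  simp only [Nat.cast_zero, pow_zero, mul_one, zero_add]

/-! ### Geometric sums at roots of unity -/

/-- `|e(u) - 1| ≥ 4|u|` for `|u| ≤ 1/2` (`|e(u) - 1| = 2|sin πu|` and Jordan's inequality). -/
theorem four_mul_abs_le_norm_exp_sub_one {u : ℝ} (hu : |u| ≤ 1 / 2) :
    4 * |u| ≤ ‖Complex.exp (2 * Real.pi * Complex.I * u) - 1‖ := by
  have e : (2 * Real.pi * Complex.I * u : ℂ) = Complex.I * ((2 * Real.pi * u : ℝ) : ℂ) := by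
    push_cast; ring
  rw [e, Complex.norm_exp_I_mul_ofReal_sub_one]
  rw [show (2 * Real.pi * u / 2 : ℝ) = Real.pi * u by ring, Real.norm_eq_abs, abs_mul,
    abs_of_pos (two_pos : (0 : ℝ) < 2)]
  -- `|sin (π u)| ≥ 2|u|`
  have key : ∀ v : ℝ, 0 ≤ v → v ≤ 1 / 2 → 2 * v ≤ Real.sin (Real.pi * v) := by
    intro v hv0 hv1
    have h := Real.mul_le_sin (x := Real.pi * v) (by positivity)
      (by nlinarith [Real.pi_pos])
    have : 2 / Real.pi * (Real.pi * v) = 2 * v := by field_simp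
    linarith
  rcases le_or_gt 0 u with hu0 | hu0
  · rw [abs_of_nonneg hu0] at hu ⊢
    have h := key u hu0 hu
    have : Real.sin (Real.pi * u) ≤ |Real.sin (Real.pi * u)| := le_abs_self _
    linarith
  · rw [abs_of_neg hu0] at hu ⊢
    have h := key (-u) (by linarith) hu
    simp only [mul_neg, Real.sin_neg] at h
    have : -Real.sin (Real.pi * u) ≤ |Real.sin (Real.pi * u)| := neg_le_abs _
    linarith

/-- **Geometric-sum bound**: for `0 < |u| ≤ 1/2`, `|Σ_{j<n} e(u)^j| ≤ 1/(2|u|)`. -/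
theorem norm_geom_sum_exp_le {u : ℝ} (hu : |u| ≤ 1 / 2) (hu0 : u ≠ 0) (n : ℕ) :
    ‖∑ j ∈ Finset.range n, Complex.exp (2 * Real.pi * Complex.I * u) ^ j‖ ≤ 1 / (2 * |u|) := by
  set z : ℂ := Complex.exp (2 * Real.pi * Complex.I * u) with hz
  have hu4 : 0 < 4 * |u| := by positivity
  have hz1 : 4 * |u| ≤ ‖z - 1‖ := four_mul_abs_le_norm_exp_sub_one hu
  have hzne : z ≠ 1 := by
    intro h
    rw [h, sub_self, norm_zero] at hz1
    linarith
  have hzn : ‖z‖ = 1 := by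
    rw [hz, Complex.norm_exp]
    simp
  rw [geom_sum_eq hzne, norm_div]
  have hnum : ‖z ^ n - 1‖ ≤ 2 := by
    calc ‖z ^ n - 1‖ ≤ ‖z ^ n‖ + ‖(1 : ℂ)‖ := norm_sub_le _ _
      _ = 2 := by rw [norm_pow, hzn, one_pow, norm_one]; norm_num
  rw [div_le_div_iff₀ (by linarith) (by positivity)]
  nlinarith [norm_nonneg (z ^ n - 1)]

/-- The same bound for a shifted range `Σ_{M < s ≤ N} e(u)^s`. -/
theorem norm_sum_Ioc_exp_pow_le {u : ℝ} (hu : |u| ≤ 1 / 2) (hu0 : u ≠ 0) (M N : ℕ) :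
    ‖∑ s ∈ Finset.Ioc M N, Complex.exp (2 * Real.pi * Complex.I * u) ^ s‖ ≤ 1 / (2 * |u|) := by
  set z : ℂ := Complex.exp (2 * Real.pi * Complex.I * u) with hz
  have hzn : ‖z‖ = 1 := by
    rw [hz, Complex.norm_exp]
    simp
  have hIoc : Finset.Ioc M N = Finset.Ico (M + 1) (N + 1) := by
    ext s; simp
  rw [hIoc, Finset.sum_Ico_eq_sum_range]
  have : ∑ k ∈ Finset.range (N + 1 - (M + 1)), z ^ (M + 1 + k) =
      z ^ (M + 1) * ∑ k ∈ Finset.range (N + 1 - (M + 1)), z ^ k := by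
    rw [Finset.mul_sum]
    refine Finset.sum_congr rfl fun k _ => ?_
    rw [pow_add]
  rw [this, norm_mul, norm_pow, hzn, one_pow, one_mul]
  exact norm_geom_sum_exp_le hu hu0 _

/-! ### Decay of the cutoff's finite Fourier transform -/

/-- **Decay.** For `0 < 2|h| ≤ q` and the support inside `[1, x]`:
`|Σ_{1≤t≤x} (c_k(t)/L^k) e(ht/q)| ≤ (q/(2|h|))^{k+1} / L^k`. -/
theorem norm_cutoff_fourier_le (M N L k x : ℕ) (hL : 0 < L) (hx : N + k * (L - 1) ≤ x)
    (q : ℕ) (h : ℤ) (hh : h ≠ 0) (hhq : 2 * |(h : ℝ)| ≤ q) :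
    ‖∑ t ∈ Finset.Icc 1 x, ((((cutoffPoly[M, N, L, k]).coeff t : ℕ) : ℂ) / (L : ℂ) ^ k) *
        Complex.exp (2 * Real.pi * Complex.I * (h : ℂ) * (t : ℂ) / (q : ℂ))‖ ≤
      ((q : ℝ) / (2 * |(h : ℝ)|)) ^ (k + 1) / (L : ℝ) ^ k := by
  have hh1 : (1 : ℝ) ≤ |(h : ℝ)| := by
    rw [← Int.cast_abs]; exact_mod_cast Int.one_le_abs hh
  have hq0 : (0 : ℝ) < q := by linarith
  set u : ℝ := (h : ℝ) / q with hu
  have hu0 : u ≠ 0 := by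
    rw [hu]; exact div_ne_zero (by exact_mod_cast hh) hq0.ne'
  have huabs : |u| = |(h : ℝ)| / q := by rw [hu, abs_div, abs_of_pos hq0]
  have hu2 : |u| ≤ 1 / 2 := by
    rw [huabs, div_le_iff₀ hq0]; linarith
  have hinv : 1 / (2 * |u|) = (q : ℝ) / (2 * |(h : ℝ)|) := by
    rw [huabs]; field_simp
  set z : ℂ := Complex.exp (2 * Real.pi * Complex.I * u) with hz
  have hterm : ∀ t : ℕ, Complex.exp (2 * Real.pi * Complex.I * (h : ℂ) * (t : ℂ) / (q : ℂ)) =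
      z ^ t := by
    intro t
    rw [hz, ← Complex.exp_nat_mul, hu]
    congr 1
    push_cast
    field_simp
  simp_rw [hterm]
  have hfac : ∑ t ∈ Finset.Icc 1 x, ((((cutoffPoly[M, N, L, k]).coeff t : ℕ) : ℂ) / (L : ℂ) ^ k) *
      z ^ t = (1 / (L : ℂ) ^ k) * ∑ t ∈ Finset.Icc 1 x,
        (((cutoffPoly[M, N, L, k]).coeff t : ℕ) : ℂ) * z ^ t := by
    rw [Finset.mul_sum]
    refine Finset.sum_congr rfl fun t _ => ?_
    ring
  rw [hfac, sum_coeff_cutoff_mul_pow M N L k x hL hx z, norm_mul, norm_mul, norm_pow,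
    norm_div, norm_one, norm_pow, Complex.norm_natCast]
  have hI := norm_sum_Ioc_exp_pow_le hu2 hu0 M N
  have hB := norm_geom_sum_exp_le hu2 hu0 L
  rw [hinv] at hI hB
  have hLk : (0 : ℝ) < (L : ℝ) ^ k := by positivity
  have hq2 : 0 ≤ (q : ℝ) / (2 * |(h : ℝ)|) := by positivity
  calc 1 / (L : ℝ) ^ k * (‖∑ s ∈ Finset.Ioc M N, z ^ s‖ * ‖∑ j ∈ Finset.range L, z ^ j‖ ^ k)
      ≤ 1 / (L : ℝ) ^ k * ((q : ℝ) / (2 * |(h : ℝ)|) * ((q : ℝ) / (2 * |(h : ℝ)|)) ^ k) := by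
        refine mul_le_mul_of_nonneg_left ?_ (by positivity)
        exact mul_le_mul hI (pow_le_pow_left₀ (norm_nonneg _) hB k) (by positivity) hq2
    _ = ((q : ℝ) / (2 * |(h : ℝ)|)) ^ (k + 1) / (L : ℝ) ^ k := by rw [pow_succ']; ring

end Summit.Parity.BatemanHorn.Cruxes.SplitBlockJacobi.CofactorRootDiscrepancy.Poisson

namespace Summit.Parity.BatemanHorn.Cruxes.SplitBlockJacobi.CofactorRootDiscrepancy

/-- **Registered stub form** of `Poisson.norm_cutoff_fourier_le`: the identical statement, declared in the crux
namespace under the name registered on stmt-Parity-11583 (`ledger workitem stub-add`). -/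
theorem norm_cutoff_fourier_le :
    ∀ (M N L k x : ℕ) (hL : 0 < L) (hx : N + k * (L - 1) ≤ x) (q : ℕ) (h : ℤ) (hh : h ≠ 0) (hhq : 2 * |(h : ℝ)| ≤ q), ‖∑ t ∈ Finset.Icc 1 x, ((((((∑ s ∈ Finset.Ioc M N, (Polynomial.X : Polynomial ℕ) ^ s) * (∑ j ∈ Finset.range L, (Polynomial.X : Polynomial ℕ) ^ j) ^ k)).coeff t : ℕ) : ℂ) / (L : ℂ) ^ k) * Complex.exp (2 * Real.pi * Complex.I * (h : ℂ) * (t : ℂ) / (q : ℂ))‖ ≤ ((q : ℝ) / (2 * |(h : ℝ)|)) ^ (k + 1) / (L : ℝ) ^ k :=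
  @Poisson.norm_cutoff_fourier_le

end Summit.Parity.BatemanHorn.Cruxes.SplitBlockJacobi.CofactorRootDiscrepancy

end
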